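/-
Summits/MatrixMultiplication/MatrixMultiplication/Theorems/TetraResidualNecessityInstances.lean
decomp-mm lens 6 («barrier-complement carving»), generation 27 — supports item 27058 (TetraPlusTwo,
the declared residual of route TetrahedronCarving).  Part 3/3: dossier pieces, record box,
rectangular carrier.
-/
import Summits.MatrixMultiplication.MatrixMultiplication.Theorems.TetraResidualNecessity

/-!
# Residual necessity, part 3: the dossier pieces, an explicit lawful region, the rectangular carrier

* `tetraExcessZeroData`, `residualPencilData c`, `tetraFlatData`, `diamondFlatData`: the pieces
  of the TetrahedronCarving dossier as support-linear data on the `K₄` carrier;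
  `tetraExcessZero_stable`, `residualPencil_zero_stable`: the ω-free ones are stable;
  `omegaFree_not_forces_k4`: no ω-free family closes `ω = 2`.
* `k4box ωbar` (box `[0,1]⁶` ∩ record caps on the four triangles), `k4box_room`,
  `k4_residual_necessity_box`, `k4_residual_necessity_flat` (mandatory set = exactly the seven
  flattening points): fully explicit instances of the headline theorem.
* `rect_residual_necessity`: the rectangular carrier `ℝ³` (generators `⟨2,1,1⟩,⟨1,2,1⟩,⟨1,1,2⟩`,
  exotic apex `(2/3,2/3,2/3) + ε(1,1,1)`).
-/

open Filter Topology Set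

namespace Summit.MatrixMultiplication.MatrixMultiplication.Theorems.TetraResidualNecessity

section K4

/-! #### The pieces of the TetrahedronCarving dossier in this language -/

/-- `TetraExcessZero : ω(K₄) ≤ ω(2,1,2)`, i.e. `sval 𝟙 - sval (𝟙 - e₀₁) ≤ 0` -/
def tetraExcessZeroData : LinData (Fin 6) :=
  ⟨2, ![1, -1], ![k4one, k4dia], 0⟩

/-- the residual pencil `B_c : 4 + c (ω - 2) ≤ ω(K₄)`, i.e. `c · sval tri - sval 𝟙 ≤ 2c - 4`
(`c = 1` is `TetraPlusTwo`, `c = 0` is the flattening bound `B_0`) -/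
def residualPencilData (c : ℝ) : LinData (Fin 6) :=
  ⟨2, ![c, -1], ![k4tri, k4one], 2 * c - 4⟩

/-- `TetraFlat : ω(K₄) ≤ 4` and the diamond cap `ψ ≤ 4` (`≡ HalfAlpha`) -/
def tetraFlatData : LinData (Fin 6) := ⟨1, ![1], ![k4one], 4⟩
/-- the diamond cap `ψ = ω(2,1,2) ≤ 4` (`≡ HalfAlpha`) as a support-linear piece -/
def diamondFlatData : LinData (Fin 6) := ⟨1, ![1], ![k4dia], 4⟩

/-- slack of the all-ones direction at `x₀`: `⟨𝟙,x₀⟩ = 7/2 < 4 = ⟨𝟙,f₁⟩ ≤ sval Δ₀ 𝟙` -/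
theorem slack_k4one {Δ₀ : Set (Fin 6 → ℝ)} (hΔ : Tame Δ₀) (hface : ∀ q ∈ k4face, q ∈ Δ₀) :
    dot k4one k4x0 < sval Δ₀ k4one := by
  have hf : dot k4one k4f1 ≤ sval Δ₀ k4one := le_sval hΔ _ (hface k4f1 (by simp [k4face]))
  have e1 : dot k4one k4x0 = 7 / 2 := by rw [dot6]; simp [k4one, k4x0]; norm_num
  have e2 : dot k4one k4f1 = 4 := by rw [dot6]; simp [k4one, k4f1]; norm_num
  linarith

/-- slack of the diamond direction at `x₀`: `⟨𝟙-e₀₁,x₀⟩ = 17/6 < 4 = ⟨𝟙-e₀₁,f₁⟩` -/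
theorem slack_k4dia {Δ₀ : Set (Fin 6 → ℝ)} (hΔ : Tame Δ₀) (hface : ∀ q ∈ k4face, q ∈ Δ₀) :
    dot k4dia k4x0 < sval Δ₀ k4dia := by
  have hf : dot k4dia k4f1 ≤ sval Δ₀ k4dia := le_sval hΔ _ (hface k4f1 (by simp [k4face]))
  have e1 : dot k4dia k4x0 = 17 / 6 := by rw [dot6]; simp [k4dia, k4x0]; norm_num
  have e2 : dot k4dia k4f1 = 4 := by rw [dot6]; simp [k4dia, k4f1]; norm_num
  linarith

/-- `TetraExcessZero` is slack at `x₀` in both of its directions; hence it is STABLE (given it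
holds at `Δ₀`): adjoining the exotic point `x₀ + ε·tri` never breaks it. -/
theorem tetraExcessZero_stable {Δ₀ : Set (Fin 6 → ℝ)} (hΔ : Tame Δ₀)
    (hface : ∀ q ∈ k4face, q ∈ Δ₀) (hnec : tetraExcessZeroData.holds Δ₀) :
    StableAlong Δ₀ (pts k4pert) tetraExcessZeroData.holds := by
  apply tetraExcessZeroData.stable_of_slack hΔ hnec k4pert
  · intro xv hxv u
    simp only [k4pert, List.mem_singleton] at hxv
    subst hxv
    exact k4x0_dominated hΔ hface u
  · intro xv hxv j _ _
    simp only [k4pert, List.mem_singleton] at hxv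
    subst hxv
    fin_cases j
    · exact slack_k4one hΔ hface
    · exact slack_k4dia hΔ hface

/-- `B_0 : 4 ≤ ω(K₄)` has no positive term: it is ω-free, hence stable (the semantic form of
`defectCone_B0_not_admissible`). -/
theorem residualPencil_zero_stable {Δ₀ : Set (Fin 6 → ℝ)} (hΔ : Tame Δ₀)
    (hface : ∀ q ∈ k4face, q ∈ Δ₀) (hnec : (residualPencilData 0).holds Δ₀) :
    StableAlong Δ₀ (pts k4pert) (residualPencilData 0).holds := by
  apply (residualPencilData 0).stable_of_slack hΔ hnec k4pert
  · intro xv hxv u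
    simp only [k4pert, List.mem_singleton] at hxv
    subst hxv
    exact k4x0_dominated hΔ hface u
  · intro xv hxv j hj _
    simp only [k4pert, List.mem_singleton] at hxv
    subst hxv
    fin_cases j
    · exfalso
      simp [residualPencilData] at hj
    · exact slack_k4one hΔ hface

/-- Generic ω-free criterion on the `K₄` carrier: every positive-coefficient direction is either
blind to the triangle (`⟨u,tri⟩ ≤ 0`) or slack at `x₀`; such families never close the summit. -/
theorem omegaFree_not_forces_k4 {Δ₀ K : Set (Fin 6 → ℝ)} (hΔ : Tame Δ₀) (hK : Δ₀ ⊆ K)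
    (hface : ∀ q ∈ k4face, q ∈ Δ₀)
    (hroom : ∀ᶠ ε in 𝓝[>] (0 : ℝ), k4x0 + ε • k4tri ∈ K)
    (Ps : List (LinData (Fin 6))) (hnec : ∀ D ∈ Ps, D.holds Δ₀)
    (hfree : ∀ D ∈ Ps, ∀ j, 0 < D.coef j → 0 < dot (D.dir j) k4tri →
      dot (D.dir j) k4x0 < sval Δ₀ (D.dir j)) :
    ¬ Forces Δ₀ K (Ps.map LinData.holds) (Cap k4tri 2) := by
  intro hF
  obtain ⟨D, hD, j, μ, hj, hμ, hdir, hM⟩ := k4_residual_necessity hΔ hK hface hroom Ps hnec hF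
  have h1 : 0 < dot (D.dir j) k4tri := by
    rw [hdir, dot_smul_left, dot_k4tri_tri]; positivity
  have h2 := hfree D hD j hj h1
  have h3 : dot (D.dir j) k4x0 = 2 * μ := by rw [hdir, dot_smul_left, dot_k4tri_x0]; ring
  linarith

/-! #### A concrete lawful region with room: the box cut by a record bound on `ω` -/

/-- box `[0,1]⁶` intersected with record upper bounds `ω ≤ ωbar` on all four triangles -/
def k4box (ωbar : ℝ) : Set (Fin 6 → ℝ) :=
  {β | (∀ i, 0 ≤ β i ∧ β i ≤ 1) ∧ dot k4tri β ≤ ωbar ∧ dot k4tri0 β ≤ ωbar ∧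
    dot k4tri1 β ≤ ωbar ∧ dot k4tri2 β ≤ ωbar}

/-- the seven flattening points are lawful (`ωbar ≥ 2`) -/
theorem k4flat_subset_box {ωbar : ℝ} (hω : 2 ≤ ωbar) : ∀ q ∈ k4flat, q ∈ k4box ωbar := by
  intro q hq
  simp only [k4flat, List.mem_cons, List.mem_nil_iff, or_false] at hq
  rcases hq with rfl | rfl | rfl | rfl | rfl | rfl | rfl <;>
  · refine ⟨fun i => ?_, ?_, ?_, ?_, ?_⟩
    · fin_cases i <;> simp [k4s0, k4s1, k4s2, k4s3, k4f1, k4f2, k4f3]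
    all_goals
      (rw [dot6]; simp [k4tri, k4tri0, k4tri1, k4tri2, k4s0, k4s1, k4s2, k4s3, k4f1, k4f2, k4f3];
        linarith)

/-- the six summit-face points are lawful (`ωbar ≥ 2`) -/
theorem k4face_subset_box {ωbar : ℝ} (hω : 2 ≤ ωbar) : ∀ q ∈ k4face, q ∈ k4box ωbar :=
  fun q hq => k4flat_subset_box hω q (k4face_sub_flat q hq)

/-- room: all four exotic points stay in the record box for small `ε` -/
theorem k4box_room {ωbar : ℝ} (hω : 2 < ωbar) :
    ∀ xv ∈ k4pertOrbit, ∀ᶠ ε in 𝓝[>] (0 : ℝ), xv.1 + ε • xv.2 ∈ k4box ωbar := by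
  have hδ : (0 : ℝ) < min (1 / 3) ((ωbar - 2) / 3) := by
    apply lt_min (by norm_num); linarith
  intro xv hxv
  filter_upwards [Ioo_mem_nhdsGT hδ] with ε hε
  rcases hε with ⟨hε0, hε1⟩
  have hεa : ε < 1 / 3 := lt_of_lt_of_le hε1 (min_le_left _ _)
  have hεb : ε < (ωbar - 2) / 3 := lt_of_lt_of_le hε1 (min_le_right _ _)
  simp only [k4pertOrbit, List.mem_cons, List.mem_nil_iff, or_false] at hxv
  rcases hxv with rfl | rfl | rfl | rfl <;>
  · refine ⟨fun i => ?_, ?_, ?_, ?_, ?_⟩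
    · fin_cases i <;> simp [k4x0, k4x0v0, k4x0v1, k4x0v2, k4tri, k4tri0, k4tri1, k4tri2] <;>
        (try constructor) <;> linarith
    all_goals
      (rw [dot6]; simp [k4x0, k4x0v0, k4x0v1, k4x0v2, k4tri, k4tri0, k4tri1, k4tri2]; linarith)

/-- room for the single exotic point `x₀ + ε·tri` -/
theorem k4box_room_one {ωbar : ℝ} (hω : 2 < ωbar) :
    ∀ᶠ ε in 𝓝[>] (0 : ℝ), k4x0 + ε • k4tri ∈ k4box ωbar :=
  k4box_room hω (k4x0, k4tri) (by simp [k4pertOrbit])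

/-- **Corollary (fully explicit instance).**  With `Δ₀` any tame set between the seven
flattening points and the record box (`ωbar > 2`, e.g. `2.3714`), every family of
support-linear pieces true at `Δ₀` that forces `ω = 2` contains an ω-bounding piece tight at
`2` (for one of the four triangles), and no ω-free family closes. -/
theorem k4_residual_necessity_box {ωbar : ℝ} (hω : 2 < ωbar) {Δ₀ : Set (Fin 6 → ℝ)}
    (hΔ : Tame Δ₀) (hK : Δ₀ ⊆ k4box ωbar) (hflat : ∀ q ∈ k4flat, q ∈ Δ₀)
    (Ps : List (LinData (Fin 6))) (hnec : ∀ D ∈ Ps, D.holds Δ₀)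
    (hF : Forces Δ₀ (k4box ωbar) (Ps.map LinData.holds) (Cap k4tri 2)) :
    ∃ D ∈ Ps, ∃ j, ∃ μ : ℝ, 0 < D.coef j ∧ 0 < μ ∧ sval Δ₀ (D.dir j) = 2 * μ ∧
      (D.dir j = μ • k4tri ∨ D.dir j = μ • k4tri0 ∨ D.dir j = μ • k4tri1 ∨
        D.dir j = μ • k4tri2) :=
  k4_residual_necessity_orbit hΔ hK hflat (k4box_room hω) Ps hnec hF

/-- the smallest admissible mandatory set: exactly the seven flattening points -/
def k4flatSet : Set (Fin 6 → ℝ) := {q | q ∈ k4flat}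

/-- the seven flattening points form a tame mandatory set -/
theorem k4flatSet_tame : Tame k4flatSet :=
  tame_of_finite (List.finite_toSet _) ⟨k4s0, by simp [k4flatSet, k4flat]⟩

/-- **Residual necessity, minimal instance**: mandatory set = the seven flattening points, lawful region = the record box. -/
theorem k4_residual_necessity_flat {ωbar : ℝ} (hω : 2 < ωbar)
    (Ps : List (LinData (Fin 6))) (hnec : ∀ D ∈ Ps, D.holds k4flatSet)
    (hF : Forces k4flatSet (k4box ωbar) (Ps.map LinData.holds) (Cap k4tri 2)) :
    ∃ D ∈ Ps, ∃ j, ∃ μ : ℝ, 0 < D.coef j ∧ 0 < μ ∧ sval k4flatSet (D.dir j) = 2 * μ ∧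
      (D.dir j = μ • k4tri ∨ D.dir j = μ • k4tri0 ∨ D.dir j = μ • k4tri1 ∨
        D.dir j = μ • k4tri2) :=
  k4_residual_necessity_box hω k4flatSet_tame
    (fun q hq => k4flat_subset_box hω.le q hq) (fun _ hq => hq) Ps hnec hF

end K4

/-! ### 4. The rectangular carrier `ℝ³` (generators `⟨2,1,1⟩,⟨1,2,1⟩,⟨1,1,2⟩`) -/

section Rect

/-- `sval Δ r3tri = ω`, `sval Δ (a,b,c) = ω(a,b,c)` -/
def r3tri : Fin 3 → ℝ := ![1, 1, 1]
/-- the three flattening points -/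
def r3fA : Fin 3 → ℝ := ![1, 1, 0]
/-- the flattening point `(1,0,1)` -/
def r3fB : Fin 3 → ℝ := ![1, 0, 1]
/-- the flattening point `(0,1,1)` -/
def r3fC : Fin 3 → ℝ := ![0, 1, 1]
/-- their centroid, the «exotic apex» direction -/
noncomputable def r3x0 : Fin 3 → ℝ := ![2/3, 2/3, 2/3]
/-- the three flattening points of the rectangular carrier -/
def r3face : List (Fin 3 → ℝ) := [r3fA, r3fB, r3fC]
/-- the single exotic perturbation `x₀ + ε·(1,1,1)` -/
noncomputable def r3pert : List ((Fin 3 → ℝ) × (Fin 3 → ℝ)) := [(r3x0, r3tri)]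

/-- the pairing on `Fin 3` written out -/
theorem dot3 (u β : Fin 3 → ℝ) : dot u β = u 0 * β 0 + u 1 * β 1 + u 2 * β 2 := by
  simp [dot, Fin.sum_univ_three]

/-- the apex lies on the summit face: `⟨(1,1,1),x₀⟩ = 2` -/
theorem dot_r3tri_x0 : dot r3tri r3x0 = 2 := by rw [dot3]; simp [r3tri, r3x0]; norm_num
/-- `⟨(1,1,1),(1,1,1)⟩ = 3 > 0` -/
theorem dot_r3tri_tri : dot r3tri r3tri = 3 := by rw [dot3]; simp [r3tri]; norm_num

/-- centroid identity `3⟨u,x₀⟩ = Σ ⟨u,f⟩` -/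
theorem dot_r3x0_eq (u : Fin 3 → ℝ) :
    3 * dot u r3x0 = dot u r3fA + dot u r3fB + dot u r3fC := by
  simp only [dot3, r3x0, r3fA, r3fB, r3fC]; simp; ring

/-- `x₀` is dominated by any tame set containing the three flattening points -/
theorem r3x0_dominated {Δ₀ : Set (Fin 3 → ℝ)} (hΔ : Tame Δ₀) (hface : ∀ q ∈ r3face, q ∈ Δ₀)
    (u : Fin 3 → ℝ) : dot u r3x0 ≤ sval Δ₀ u := by
  have hA := le_sval hΔ u (hface r3fA (by simp [r3face]))
  have hB := le_sval hΔ u (hface r3fB (by simp [r3face]))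
  have hC := le_sval hΔ u (hface r3fC (by simp [r3face]))
  have := dot_r3x0_eq u
  linarith

/-- **Facet lemma (rectangular)**: bounded by `M` on the three flattening points and reaching `M` at `x₀` forces `u = μ • (1,1,1)`, `M = 2μ`. -/
theorem r3_facet (u : Fin 3 → ℝ) (M : ℝ) (hA : dot u r3fA ≤ M) (hB : dot u r3fB ≤ M)
    (hC : dot u r3fC ≤ M) (hx : M ≤ dot u r3x0) : u = (u 0) • r3tri ∧ M = 2 * u 0 := by
  have hc := dot_r3x0_eq u
  simp only [dot3, r3fA, r3fB, r3fC, r3x0] at hA hB hC hc hx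
  simp at hA hB hC hc hx
  have e1 : u 1 = u 0 := by linarith
  have e2 : u 2 = u 0 := by linarith
  refine ⟨?_, by linarith⟩
  funext i
  fin_cases i <;> simp [r3tri, e1, e2]

/-- **Residual necessity on the rectangular carrier**: every finite family of support-linear
statements about rectangular exponents (single bounds `ω(a,b,c) ≤ r`, format dominations,
linear relations `Σ λ_j ω(a_j,b_j,c_j) ≤ r`), each true at `Δ₀`, that forces `ω = 2` contains
a piece in which `ω(μ,μ,μ) = μω` occurs with a positive coefficient, tight at `2μ`. -/
theorem rect_residual_necessity {Δ₀ K : Set (Fin 3 → ℝ)} (hΔ : Tame Δ₀) (hK : Δ₀ ⊆ K)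
    (hface : ∀ q ∈ r3face, q ∈ Δ₀)
    (hroom : ∀ᶠ ε in 𝓝[>] (0 : ℝ), r3x0 + ε • r3tri ∈ K)
    (Ps : List (LinData (Fin 3))) (hnec : ∀ D ∈ Ps, D.holds Δ₀)
    (hF : Forces Δ₀ K (Ps.map LinData.holds) (Cap r3tri 2)) :
    ∃ D ∈ Ps, ∃ j, ∃ μ : ℝ, 0 < D.coef j ∧ 0 < μ ∧ D.dir j = μ • r3tri ∧
      sval Δ₀ (D.dir j) = 2 * μ := by
  have hroom' : ∀ xv ∈ r3pert, ∀ᶠ ε in 𝓝[>] (0 : ℝ), xv.1 + ε • xv.2 ∈ K := by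
    intro xv hxv
    simp only [r3pert, List.mem_singleton] at hxv
    subst hxv
    exact hroom
  have hx : ∀ xv ∈ r3pert, ∀ u, dot u xv.1 ≤ sval Δ₀ u := by
    intro xv hxv u
    simp only [r3pert, List.mem_singleton] at hxv
    subst hxv
    exact r3x0_dominated hΔ hface u
  obtain ⟨D, hD, xv, hxv, j, hj, hjv, htight⟩ :=
    residual_necessity hΔ hK r3pert hroom' hx (xv₀ := (r3x0, r3tri)) (by simp [r3pert])
      dot_r3tri_x0 (by rw [dot_r3tri_tri]; norm_num) Ps hnec hF
  simp only [r3pert, List.mem_singleton] at hxv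
  subst hxv
  have hb := fun q hq => le_sval hΔ (D.dir j) (hface q hq)
  obtain ⟨hdir, hM⟩ := r3_facet (D.dir j) (sval Δ₀ (D.dir j))
    (hb r3fA (by simp [r3face])) (hb r3fB (by simp [r3face])) (hb r3fC (by simp [r3face])) htight
  refine ⟨D, hD, j, D.dir j 0, hj, ?_, hdir, hM⟩
  have : dot (D.dir j) r3tri = D.dir j 0 * 3 := by
    rw [hdir, dot_smul_left, dot_r3tri_tri]
    simp [r3tri]
  nlinarith [hjv, this]

end Rect

end Summit.MatrixMultiplication.MatrixMultiplication.Theorems.TetraResidualNecessity
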